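import Mathlib
import Literature.MathematicalPhysics.MHD.SolovevFluxSurfaceForceBalance
import Summits.Ventures.FusionMHD.Models.SolovevPCFSafetyFactorProfile
import HarnessLib

/-!
# Ventures/FusionMHD — Models/SolovevPCFGGJData.lean: the Glasser–Greene–Johnson / Mercier (8.134) surface
# data of EVERY flux surface of the two F1.a analytic equilibria of record, as one typed record per surface

HONEST FRAMING (LADDER-GRIDFUSION three columns). MODELLED: the ANALYTIC Pataki–Cerfon–Freidberg Solov'ev
instances of `Models/SolovevPCF.lean` (ideal MHD, axisymmetric, `μ₀p′ = −1`, `FF′ = 0`, fixed boundary;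
«ITER-like»/«NSTX-like» name printed shape triples only), free constant `F = RB_φ`. CERTIFIED content (kernel,
this file): exact identities; no enclosure, no stability word. The criterion typed by gridfusion-lit-3
(`Literature/…/MercierFluxForm.lean`, Jardin 2010 (8.134) verbatim on `Mercier.FluxForm.SurfaceData`) is a
NECESSARY condition for ideal-MHD stability against localized interchange.

For each instance (`IterLike`, `NstxLike`) and every surface label `0 < r < R_a/2` (the plasma edge is
`r = ε/R_a`, admissible by `edge_minorRadius` of `Models/SolovevPCFSafetyFactorProfile.lean`):
* `ggjData F r` — the thirteen (8.134) inputs of the surface as the generic Lee–Cerfon record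
  `Solovev.lcGGJData κ₀ F R_a (q₀F) (ε/R_a) F r` (label `ψ := Ψ`, Jardin orientation; `psi_eq_psiLC`: the
  instance IS that Lee–Cerfon equilibrium), so every field is an explicit one-dimensional integral by
  `Literature/…/SolovevFluxSurfaceGGJ{Averages,Derivs,Data}.lean`;
* `csLC_eq_one` — the Lee–Cerfon source constant of the instance is `C_s = 1` (`Δ*Ψ = R²`), hence
  `ggjData_p'` (`p′ = −1`), `ggjData_gσB2` (`⟨σB²/|∇Ψ|²⟩ = F·⟨1/|∇Ψ|²⟩`), `ggjData_I'` (`I′ = V′/(2π)`);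
* `ggjData_V'`/`ggjData_Φ'` — `V′`, `Φ′` are Freidberg's (6.22) and `2π×`(6.35) functionals OF THE INSTANCE'S
  OWN `psi` on the printed loop;
* `ggjData_isForceBalanced`, `mercierCriterion_ggjData_relabel_iff` — force balance holds, so the criterion is
  label-independent; `mercierCriterion_ggjData_iff` — certification form `0 < mercierNumerator`.
A Bench certificate for a surface is then ONE statement `(ggjData F r).MercierCriterion` closed from rational
enclosures of eight smooth periodic integrals. Typer/prover: gridfusion-model-5 (g3), 2026-08-27.
Citations: Jardin 2010 (8.134) [Jardin2010]; Freidberg 2014 (6.22)/(6.27)/(6.35) [Freidberg2014];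
Lee–Cerfon 2015 §4.1 [LeeCerfon2015]; Pataki–Cerfon–Freidberg 2013 §6.1 [PatakiCerfonFreidberg2013].
-/

noncomputable section

namespace Summit.Ventures.FusionMHD.Models.SolovevPCF

open Literature.MathematicalPhysics.MHD Literature.MathematicalPhysics.MHD.GradShafranov
  Literature.MathematicalPhysics.MHD.Solovev Literature.MathematicalPhysics.MHD.Mercier.FluxForm _root_.Real

namespace IterLike

/-- The GGJ / Mercier (8.134) surface data of the surface `r` of the ITER-like instance, free constant `F`:
the generic Lee–Cerfon record with the instance's parameters `(κ₀, F, R_a, q₀(F), ε/R_a)` and `g = F`.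
MODELLED: ideal MHD, Solov'ev profiles, analytic fixed boundary. -/
def ggjData (F r : ℝ) : SurfaceData := lcGGJData kappa0 F Ra (q0 F) (ε / Ra) F r

/-- The Lee–Cerfon source constant of the instance is `C_s = 1` (`Δ*Ψ = R²`; `F > 0`). -/
theorem csLC_eq_one {F : ℝ} (hF : 0 < F) : csLC kappa0 F Ra (q0 F) = 1 := by
  have hA := lcAmplitude hF.ne'
  have hk0 := kappa0_pos
  have hq := q0_pos hF
  have hRa := Ra_pos
  have e : csLC kappa0 F Ra (q0 F)
      = 2 * (kappa0 * F / (2 * Ra ^ 3 * q0 F)) * (1 + 1 / kappa0 ^ 2) := by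
    unfold csLC
    field_simp
  rw [e, hA, kappa0_sq]
  unfold elongSq d₃
  norm_num

section surface

variable {F r : ℝ} (hF : 0 < F) (hr : 0 < r) (h2r : 2 * r < Ra)
include hF hr h2r

omit hr h2r in
/-- `V′` of the record is Freidberg's `dV/dψ` (6.22) of the instance's own `psi` on the printed loop. -/
theorem ggjData_V' : (ggjData F r).V' = volumeDerivE psi (lcLoop Ra kappa0 r) (2 * π) := by
  show volumeDerivE (psiLC kappa0 F Ra (q0 F) (ε / Ra)) _ _ = _
  rw [← psi_eq_psiLC hF.ne']

/-- `Φ′` of the record is Jardin's (5.31) integrand of the instance's own `psi`, `= 2π·q` (Freidberg (6.35)). -/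
theorem ggjData_Φ' :
    (ggjData F r).Φ' = 2 * π * safetyFactorE F psi (lcLoop Ra kappa0 r) (2 * π) := by
  show toroidalFluxDerivJ F (psiLC kappa0 F Ra (q0 F) (ε / Ra)) _ _ = _
  rw [toroidalFluxDerivJ_eq (volumeDerivE_lcLoop_pos Ra_pos kappa0_pos hF (q0_pos hF) hr h2r _).ne',
    ← psi_eq_psiLC hF.ne']

/-- `V′ ≠ 0` (regular surface). -/
theorem ggjData_V'_ne : (ggjData F r).V' ≠ 0 :=
  lcGGJData_V'_ne Ra_pos kappa0_pos hF (q0_pos hF) hr h2r _ _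

omit hr h2r in
/-- `p′ = −1` (`μ₀p′ = −Δ*Ψ/R² = −1`). -/
theorem ggjData_p' : (ggjData F r).p' = -1 := by
  show -csLC kappa0 F Ra (q0 F) = -1
  rw [csLC_eq_one hF]

omit hF hr h2r in
/-- `Ψ′ = 2π`, `Ψ″ = 0`, `K′ = 0` (label `Ψ`, Jardin orientation, `FF′ = 0`). -/
theorem ggjData_labels : (ggjData F r).Ψ' = 2 * π ∧ (ggjData F r).Ψ'' = 0 ∧ (ggjData F r).K' = 0 :=
  ⟨rfl, rfl, rfl⟩

/-- `⟨σB²/|∇Ψ|²⟩ = F·∫w/G ÷ ∫w` (`σB² = F` on the instance). -/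
theorem ggjData_gσB2 :
    (ggjData F r).gσB2
      = F * ((∫ t in (0 : ℝ)..(2 * π),
            lcAvgWeight kappa0 F Ra (q0 F) r t / lcGradSq kappa0 F Ra (q0 F) r t)
          / ∫ t in (0 : ℝ)..(2 * π), lcAvgWeight kappa0 F Ra (q0 F) r t) := by
  show (lcGGJData kappa0 F Ra (q0 F) (ε / Ra) F r).gσB2 = _
  rw [lcGGJData_gσB2 Ra_pos kappa0_pos hF (q0_pos hF) hr h2r, csLC_eq_one hF, one_mul]

/-- `I′ = V′/(2π)` (force balance with `p′ = −1`, `Ψ′ = 2π`). -/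
theorem ggjData_I' : (ggjData F r).I' = (ggjData F r).V' / (2 * π) := by
  show (lcGGJData kappa0 F Ra (q0 F) (ε / Ra) F r).I' = (lcGGJData kappa0 F Ra (q0 F) (ε / Ra) F r).V' / _
  rw [lcGGJData_I'_eq Ra_pos kappa0_pos hF (q0_pos hF) hr h2r, csLC_eq_one hF, one_mul]

/-- **Surface-averaged force balance holds on every surface of the ITER-like instance.** -/
theorem ggjData_isForceBalanced : (ggjData F r).IsForceBalanced :=
  lcGGJData_isForceBalanced Ra_pos kappa0_pos hF (q0_pos hF) hr h2r _ _

/-- The Mercier criterion of the surface is label-independent (any relabelling `h′ = h1 ≠ 0`, `h″ = h2`). -/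
theorem mercierCriterion_ggjData_relabel_iff (h1 h2 : ℝ) (hh : h1 ≠ 0) :
    ((ggjData F r).relabel h1 h2).MercierCriterion ↔ (ggjData F r).MercierCriterion :=
  mercierCriterion_lcGGJData_relabel_iff Ra_pos kappa0_pos hF (q0_pos hF) hr h2r _ _ h1 h2 hh

/-- Certification form: `MercierCriterion ↔ 0 < mercierNumerator` (gridfusion-lit-3). -/
theorem mercierCriterion_ggjData_iff :
    (ggjData F r).MercierCriterion ↔ 0 < (ggjData F r).mercierNumerator :=
  SurfaceData.mercierCriterion_iff_numerator_pos _ (ggjData_V'_ne hF hr h2r)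

end surface

-- The edge surface `r = ε/R_a` (plasma boundary `Ψ = 0`) is admissible by `edge_minorRadius`
-- (`Models/SolovevPCFSafetyFactorProfile.lean`): `ggjData F (ε/R_a)` is the record of the boundary.

end IterLike

namespace NstxLike

/-- The GGJ / Mercier (8.134) surface data of the surface `r` of the NSTX-like instance, free constant `F`.
MODELLED: ideal MHD, Solov'ev profiles, analytic fixed boundary. -/
def ggjData (F r : ℝ) : SurfaceData := lcGGJData kappa0 F Ra (q0 F) (ε / Ra) F r

/-- The Lee–Cerfon source constant of the instance is `C_s = 1` (`Δ*Ψ = R²`; `F > 0`). -/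
theorem csLC_eq_one {F : ℝ} (hF : 0 < F) : csLC kappa0 F Ra (q0 F) = 1 := by
  have hA := lcAmplitude hF.ne'
  have hk0 := kappa0_pos
  have hq := q0_pos hF
  have hRa := Ra_pos
  have e : csLC kappa0 F Ra (q0 F)
      = 2 * (kappa0 * F / (2 * Ra ^ 3 * q0 F)) * (1 + 1 / kappa0 ^ 2) := by
    unfold csLC
    field_simp
  rw [e, hA, kappa0_sq]
  unfold elongSq d₃
  norm_num

section surface

variable {F r : ℝ} (hF : 0 < F) (hr : 0 < r) (h2r : 2 * r < Ra)
include hF hr h2r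

omit hr h2r in
/-- `V′` of the record is Freidberg's `dV/dψ` (6.22) of the instance's own `psi` on the printed loop. -/
theorem ggjData_V' : (ggjData F r).V' = volumeDerivE psi (lcLoop Ra kappa0 r) (2 * π) := by
  show volumeDerivE (psiLC kappa0 F Ra (q0 F) (ε / Ra)) _ _ = _
  rw [← psi_eq_psiLC hF.ne']

/-- `Φ′ = 2π·q` of the instance's own `psi` (Freidberg (6.35)). -/
theorem ggjData_Φ' :
    (ggjData F r).Φ' = 2 * π * safetyFactorE F psi (lcLoop Ra kappa0 r) (2 * π) := by
  show toroidalFluxDerivJ F (psiLC kappa0 F Ra (q0 F) (ε / Ra)) _ _ = _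
  rw [toroidalFluxDerivJ_eq (volumeDerivE_lcLoop_pos Ra_pos kappa0_pos hF (q0_pos hF) hr h2r _).ne',
    ← psi_eq_psiLC hF.ne']

/-- `V′ ≠ 0` (regular surface). -/
theorem ggjData_V'_ne : (ggjData F r).V' ≠ 0 :=
  lcGGJData_V'_ne Ra_pos kappa0_pos hF (q0_pos hF) hr h2r _ _

omit hr h2r in
/-- `p′ = −1`. -/
theorem ggjData_p' : (ggjData F r).p' = -1 := by
  show -csLC kappa0 F Ra (q0 F) = -1
  rw [csLC_eq_one hF]

/-- `I′ = V′/(2π)`. -/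
theorem ggjData_I' : (ggjData F r).I' = (ggjData F r).V' / (2 * π) := by
  show (lcGGJData kappa0 F Ra (q0 F) (ε / Ra) F r).I' = (lcGGJData kappa0 F Ra (q0 F) (ε / Ra) F r).V' / _
  rw [lcGGJData_I'_eq Ra_pos kappa0_pos hF (q0_pos hF) hr h2r, csLC_eq_one hF, one_mul]

/-- **Surface-averaged force balance holds on every surface of the NSTX-like instance.** -/
theorem ggjData_isForceBalanced : (ggjData F r).IsForceBalanced :=
  lcGGJData_isForceBalanced Ra_pos kappa0_pos hF (q0_pos hF) hr h2r _ _

/-- Label independence of the criterion. -/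
theorem mercierCriterion_ggjData_relabel_iff (h1 h2 : ℝ) (hh : h1 ≠ 0) :
    ((ggjData F r).relabel h1 h2).MercierCriterion ↔ (ggjData F r).MercierCriterion :=
  mercierCriterion_lcGGJData_relabel_iff Ra_pos kappa0_pos hF (q0_pos hF) hr h2r _ _ h1 h2 hh

/-- Certification form: `MercierCriterion ↔ 0 < mercierNumerator`. -/
theorem mercierCriterion_ggjData_iff :
    (ggjData F r).MercierCriterion ↔ 0 < (ggjData F r).mercierNumerator :=
  SurfaceData.mercierCriterion_iff_numerator_pos _ (ggjData_V'_ne hF hr h2r)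

end surface

-- The edge surface `r = ε/R_a` is admissible by `edge_minorRadius` (SafetyFactorProfile file).

end NstxLike

end Summit.Ventures.FusionMHD.Models.SolovevPCF
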